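import Summits.AnomalousDissipation.AnomalousDissipation.Theorems.SolenoidalFractalHomogenisationLagrangianStepOneLevelSplitDefsH
import Summits.AnomalousDissipation.AnomalousDissipation.Theorems.SolenoidalFractalHomogenisationRealisedQuasiStaticCellLawSectorReduction
import Literature.Analysis.FluidPDE.PassiveVectorTensorLipschitzTest
import HarnessLib

/-!
# K1L_D (stmt-AnomalousDissipation-27980), (ℓ3) (D-TH)₀ — the GRADED FROZEN-FRAME high-label decay clause `HighLabelDecayWthg` (W_θg)
# (Summits-side definitions file of route `SolenoidalFractalHomogenisation`; review lane; `--supports stmt-AnomalousDissipation-27980 --as helper`)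

TEXT OF RECORD by tenure RULING D28-19 (2)/(3) (trigger (T-c)) after the certifier's 3-probe PASS (planner ad-ideate-p5 g16, 2026-08-29T14:25:51Z, kernel evidence
`Cruxes/LagrangianRenormalisationStep/Lines/onelevel_wthg_3probe_p5.lean` c1727952a21f); candidate = prover ad-sawtooth-k1loc-p1 g16's
`HOME/ad-sawtooth-k1loc-p1/g16/HighLabelDecayWthg-candidate.lean` (sha256 8c17164b…), memo `…/g16/DTH-costline-k1locp1g16.md` (finding F-p1g16-1: the high rows
of the four distorted blocks `BlockBoundGF/GJ … Px Pζ` need a W7 statement for the DISTORTED cell member; over the abstract class `IsFrameModulation` that is an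
ENGINE statement, not a consumer of the flat clause; road of record = graded FROZEN-FRAME W7 + un-freezing glue, the (V) → (V_θg) precedent of RULING D28-3).

`HighLabelDecayWthg W M hM lo hi Λ β ν₀ Kb CK cK θW` = `HighLabelDecayW W M hM lo hi Λ β ν₀ Kb CK cK` (`…OneLevelSplitDefsH` l.34) VERBATIM except:
* the FRAME PREFIX of `VmodDist.SlowVectorClauseFθg` (…VmodDistortedDefs l.180, byte-identical): `∀ θ ∈ Icc 0 θW, ∀ G₀, G₀.det = 1 → (∀ i j, |G₀ i j − 1 i j| ≤ θ) →`
  — a CONSTANT unimodular frame in the entrywise `θ`-ball;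
* the datum binder `IsDatum F` spelled as its three conjuncts with `G₀`-SOLENOIDALITY `IsWeaklyDivFree (distort (fun _ => G₀) F)` in place of `IsWeaklyDivFree F`
  (the frozen-frame constraint `∇·(G₀F) = 0`; the high-label support condition stays on the FLAT modes of `F` — a constant frame acts modewise);
* the solution class `Torus.IsWeakTensorPassiveVectorDistortedOn 0 T ((1/n²)𝔸) (cellField W M hM ν hν.1 n) (fun _ _ => G₀) F u` (constant frame; the same
  object as (V_θg)'s l.188).
Conclusion `θ`-free (uniform `CK, cK` on the ball).  Radius `θW = 0` IS the flat clause, both ways (`wthg_zero_iff` below — certifier probe (P1), proofs ported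
from the probe file): so the graded family is a STRENGTHENING of the registered-and-proved flat W7 whose radius-0 rung is W7 itself (`highLabelDecayWthg_mono_θW`).
SUPPLIER (to come): the twisted port of the W7 engine for `cubatureWord` (this lineage: `…W7ThreeModeDefsR/FibreR` p724944/p725538, `…W7SlotStepR` p725843, …) ⇒
the v29 registered producer `stub_W7thg` (D28-19′ (a)).  CONSUMER slot: `Z7Glue.Xθgw` (`…Z7GlueEulerThetaDefsW`).  Definitions + rung lemmas only; NOT a proof of
`stub_W7thg`, of any block, of K1L_D or of AD; rung F-D1.A0.
[cite: BedrossianCotiZelati2017, Thm 1.1 (enhanced dissipation in shear flows) — the mechanism; the clause is this route's hypothesis (graded W7), text p1 g16 / p5 g16] [problem: turb]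
-/

set_option linter.dupNamespace false

namespace Summit.AnomalousDissipation.AnomalousDissipation.Theorems.SolenoidalFractalHomogenisation.LagrangianStep

open Literature.Analysis Literature.Analysis.FluidPDE Literature.Analysis.FunctionSpaces
open MeasureTheory Set
open scoped InnerProductSpace

noncomputable section

/-- **(W_θg) GRADED FROZEN-FRAME HIGH-LABEL DECAY clause** `HighLabelDecayWthg W M hM lo hi Λ β ν₀ Kb CK cK θW` (text of record, RULING D28-19): for every
constant unimodular frame `G₀` with `|G₀ − 1| ≤ θ ≤ θW` entrywise, every member `(ν, n, 𝔸)` of the window, every label threshold `L` with `n·ν ≤ Kb·L`, every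
`H¹`, zero-mean, `G₀`-SOLENOIDAL datum `F` carrying no Fourier modes on Bloch labels of norm `< L`, every weak solution `u` of the FROZEN-FRAME distorted cell problem
(drift `cellField W M hM ν n`, tensor `(1/n²)𝔸`, constant distortion `G₀`) from `F` decays at the `ν`-uniform, `θ`-uniform rate:
`∫‖u t‖² ≤ CK·exp(−2·cK·ν·t)·∫‖F‖²` for a.e. `t ∈ (0,T)`.  At `θW = 0` this is `HighLabelDecayW` (`wthg_zero_iff`).
[cite: BedrossianCotiZelati2017, Thm 1.1 (enhanced dissipation in shear flows) — the mechanism; the clause itself is this route's hypothesis (graded W7), text p1 g16 / certifier p5 g16] -/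
def HighLabelDecayWthg {k : ℕ} (W : LatticeShear.LatticeWord k) (M : ℝ) (hM : 0 < M) (lo hi Λ β ν₀ Kb CK cK θW : ℝ) : Prop :=
  ∀ θ ∈ Set.Icc 0 θW, ∀ G₀ : Matrix (Fin 3) (Fin 3) ℝ, G₀.det = 1 → (∀ i j, |G₀ i j - (1 : Matrix (Fin 3) (Fin 3) ℝ) i j| ≤ θ) →
  ∀ ν, ∀ hν : ν ∈ Set.Ioo 0 ν₀, ∀ n : ℕ, 1 ≤ n → ∀ 𝔸 : Torus.Visc4 (Fin 3),
    Torus.OddSmall 𝔸 (ν * β) → (∃ lam ∈ Set.Icc (1:ℝ) Λ, Torus.NearIso 𝔸 (ν * (lo / lam)) (ν * (hi * lam))) →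
    ∀ L > (0:ℝ), (n : ℝ) * ν ≤ Kb * L →
    ∀ F : VF, FunctionSpaces.Torus.MemSobolev 1 (FunctionSpaces.EuclideanSpace.complexify ∘ F) → FunctionSpaces.Torus.HasZeroMean F →
      FunctionSpaces.Torus.IsWeaklyDivFree (Torus.distort (fun _ => G₀) F) →
      (∀ k' : Fin 3 → ℤ, (∃ ℓ z : Fin 3 → ℤ, ‖Torus.latticeVec ℓ‖ < L ∧ k' = ℓ + (n : ℤ) • z) → ∀ i, modeCoeff k' F i = 0) →
      ∀ T > (0:ℝ), ∀ u : ℝ → VF,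
        Torus.IsWeakTensorPassiveVectorDistortedOn 0 T ((1 / (n:ℝ) ^ 2) • 𝔸) (cellField W M hM ν hν.1 n) (fun _ _ => G₀) F u →
        ∀ᵐ t ∂(volume.restrict (Ioo 0 T)),
          ∫ x, ‖u t x‖ ^ 2 ≤ CK * Real.exp (-(2 * cK * ν * t)) * ∫ x, ‖F x‖ ^ 2

/-- The graded clause is antitone in the radius `θW` (a smaller ball is a weaker demand). -/
theorem highLabelDecayWthg_mono_θW {k : ℕ} {W : LatticeShear.LatticeWord k} {M : ℝ} {hM : 0 < M} {lo hi Λ β ν₀ Kb CK cK θW θW' : ℝ}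
    (hle : θW' ≤ θW) (h : HighLabelDecayWthg W M hM lo hi Λ β ν₀ Kb CK cK θW) : HighLabelDecayWthg W M hM lo hi Λ β ν₀ Kb CK cK θW' :=
  fun θ hθ => h θ ⟨hθ.1, hθ.2.trans hle⟩

/-- A larger prefactor `CK` is weaker. -/
theorem highLabelDecayWthg_mono_CK {k : ℕ} {W : LatticeShear.LatticeWord k} {M : ℝ} {hM : 0 < M} {lo hi Λ β ν₀ Kb CK CK' cK θW : ℝ}
    (hCK : CK ≤ CK') (h : HighLabelDecayWthg W M hM lo hi Λ β ν₀ Kb CK cK θW) : HighLabelDecayWthg W M hM lo hi Λ β ν₀ Kb CK' cK θW := by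
  intro θ hθ G₀ hdet hG ν hν n hn 𝔸 hodd hwin L hL hKL F hF1 hF2 hF3 hlab T hT u hu
  filter_upwards [h θ hθ G₀ hdet hG ν hν n hn 𝔸 hodd hwin L hL hKL F hF1 hF2 hF3 hlab T hT u hu] with t ht
  refine ht.trans ?_
  gcongr

/-- A smaller quasi-static threshold `ν₀` is weaker. -/
theorem highLabelDecayWthg_mono_ν₀ {k : ℕ} {W : LatticeShear.LatticeWord k} {M : ℝ} {hM : 0 < M} {lo hi Λ β ν₀ ν₀' Kb CK cK θW : ℝ}
    (hle : ν₀' ≤ ν₀) (h : HighLabelDecayWthg W M hM lo hi Λ β ν₀ Kb CK cK θW) : HighLabelDecayWthg W M hM lo hi Λ β ν₀' Kb CK cK θW :=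
  fun θ hθ G₀ hdet hG ν hν => h θ hθ G₀ hdet hG ν ⟨hν.1, lt_of_lt_of_le hν.2 hle⟩

/-! ## The radius-`0` rung: `HighLabelDecayWthg … 0 ↔ HighLabelDecayW …` (certifier probe (P1), both directions) -/

/-- **Rung, downwards**: the graded clause at ANY radius `θW ≥ 0` gives the flat clause `HighLabelDecayW` (take `θ = 0`, `G₀ = 1`: a flat weak solution is a
`G ≡ 1` distorted one by `IsWeakTensorPassiveVectorOn.toDistorted_one`, the datum is `L²` by `H¹ ⊆ L²`, `distort_one`).  With `stub_W7thg` (v29) this makes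
the registered-and-proved flat family (H) the `θW ↓ 0` shadow of the graded producer. -/
theorem highLabelDecayW_of_wthg {k : ℕ} {W : LatticeShear.LatticeWord k} {M : ℝ} {hM : 0 < M} {lo hi Λ β ν₀ Kb CK cK θW : ℝ}
    (hθW : 0 ≤ θW) (h : HighLabelDecayWthg W M hM lo hi Λ β ν₀ Kb CK cK θW) : HighLabelDecayW W M hM lo hi Λ β ν₀ Kb CK cK := by
  intro ν hν n hn 𝔸 hodd hwin L hL hKL F hF hlab T hT u hu
  have h1 : ∀ i j, |(1 : Matrix (Fin 3) (Fin 3) ℝ) i j - (1 : Matrix (Fin 3) (Fin 3) ℝ) i j| ≤ (0:ℝ) := fun i j => by simp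
  have hdiv : FunctionSpaces.Torus.IsWeaklyDivFree (Torus.distort (fun _ => (1 : Matrix (Fin 3) (Fin 3) ℝ)) F) := by
    rw [Torus.distort_one]; exact hF.2.2
  have hF2 : MemLp F 2 volume := RealisedQuasiStaticCellLaw.memLp_two_of_memSobolev_one_complexify hF.1
  exact h 0 ⟨le_rfl, hθW⟩ 1 Matrix.det_one h1 ν hν n hn 𝔸 hodd hwin L hL hKL F hF.1 hF.2.1 hdiv hlab T hT u (hu.toDistorted_one hF2)

/-- **Rung, upwards**: the flat clause IS the radius-`0` graded clause (`|G₀ − 1| ≤ 0` forces `G₀ = 1`; a `G ≡ 1` distorted solution is flat by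
`IsWeakTensorPassiveVectorDistortedOn.of_one_toFlat`). -/
theorem wthg_zero_of_highLabelDecayW {k : ℕ} {W : LatticeShear.LatticeWord k} {M : ℝ} {hM : 0 < M} {lo hi Λ β ν₀ Kb CK cK : ℝ}
    (h : HighLabelDecayW W M hM lo hi Λ β ν₀ Kb CK cK) : HighLabelDecayWthg W M hM lo hi Λ β ν₀ Kb CK cK 0 := by
  intro θ hθ G₀ _hdet hG ν hν n hn 𝔸 hodd hwin L hL hKL F hF1 hF2 hF3 hlab T hT u hu
  have hθ0 : θ = 0 := le_antisymm hθ.2 hθ.1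
  have hG1 : G₀ = 1 := by
    ext i j
    have := hG i j; rw [hθ0] at this
    have := abs_nonpos_iff.mp this
    linarith [this, sub_eq_zero.mp this]
  subst hG1
  have hF3' : FunctionSpaces.Torus.IsWeaklyDivFree F := by rwa [Torus.distort_one] at hF3
  have hu' : Torus.IsWeakTensorPassiveVectorOn 0 T ((1 / (n:ℝ) ^ 2) • 𝔸) (cellField W M hM ν hν.1 n) F u :=
    Torus.IsWeakTensorPassiveVectorDistortedOn.of_one_toFlat (by simpa using hu)
  exact h ν hν n hn 𝔸 hodd hwin L hL hKL F ⟨hF1, hF2, hF3'⟩ hlab T hT u hu'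

/-- **The radius-`0` rung is exactly the flat clause.** -/
theorem wthg_zero_iff {k : ℕ} {W : LatticeShear.LatticeWord k} {M : ℝ} {hM : 0 < M} {lo hi Λ β ν₀ Kb CK cK : ℝ} :
    HighLabelDecayWthg W M hM lo hi Λ β ν₀ Kb CK cK 0 ↔ HighLabelDecayW W M hM lo hi Λ β ν₀ Kb CK cK :=
  ⟨highLabelDecayW_of_wthg le_rfl, wthg_zero_of_highLabelDecayW⟩

end

end Summit.AnomalousDissipation.AnomalousDissipation.Theorems.SolenoidalFractalHomogenisation.LagrangianStep
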